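import Summits.HodgeConjecture.CorCM.Census.MultiFieldWeilJointTransitive
import HarnessLib

/-!
# MULTI-FIELD WEIL, census part 4: the DEFECT LAW from JOINT SET-TRANSITIVITY — any number of CM fields with SEVERAL-MEMBER types, realised tuples jointly
# transitive on the tuples of translates of the position sets, one SEPARATION condition per slot

COR-CM (cell `pub-hodgecm2`), seat b30 gen 29 (2026-08-24); count-neutral own lane MULTI-FIELD WEIL ENGINE (stem `MultiFieldWeil*`), sequel of
`Census/MultiFieldWeilJointTransitive.lean` (the ONE-member case).  Theorems of the finite model plus bookkeeping definitions (`JointSetTransitiveG`; `preG` = preimage of a position set under a slot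
permutation, `orbitG` = the `R`-orbit of a position set in one slot); no named fact, no geometry, no `sorry`, no `decide`.

THE ARGUMENT (the several-member form of gen 28ʼs `defectG_of_signed_jointTransitive`; the uniform shape behind gen 26ʼs `SexticOcticWeil`, gen 19ʼs `OcticWeilFourfold`
and gen 29ʼs `OcticDecicWeil22` octic slot).  Read each type at a position set `P m` (`p_m = |P m|` members over `τ`, curve multiplicity `c_m = n_m − 2 p_m`).  For a tuple
`π` the signed equation reads `e + Σ_m (2 D_m(Q_m) − Σ_a d_m(a)) = 0` with `Q_m = π_m⁻¹(P m)` and `D_m(Q) = Σ_{a ∈ Q} d_m(a)`.  If the realised tuples move EVERY tuple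
`(Q_m)_m` of a family `∏_m 𝒳_m ∋ (P m)_m` onto `(P m)_m` (`JointSetTransitiveG` — downstream: orbits of pairwise coprime sizes, or a single slot), comparing the base tuple
with the base tuple changed in one slot gives `D_m(Q) = D_m(P m)` for all `Q ∈ 𝒳_m`; a SEPARATION property of `𝒳_m` (`hsep`: such a `d_m` is constant — automatic when
`𝒳_m` contains all singletons, **`sep_of_singletons`**, or all `p`-subsets with `0 < p < n`, **`sep_of_powersetCard`**) then gives `d_m ≡ t_m`, and the base equation gives
`e = Σ_m (n_m − 2 p_m) t_m`: **`defectG_of_signed_jointSetTransitive`**, on configurations **`exists_hasDefectsG_of_jointSetTransitiveG`** — the hypothesis `hdef` of the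
generic headline `MultiFieldWeil.hodgeConjectureFor_biproduct_comp_of_defectLawG`.  SLOTWISE form for composing mechanisms (peel some slots first — e.g. by a pure rotation of a
prime slot — then the rest by joint set-transitivity ON THE REMAINING SLOTS): **`const_of_signed_jointSetTransitive_on`** (the contribution of an already-constant slot to the
signed equation does not depend on the tuple), and the assembly **`exists_defects_of_const`** (all slot defects constant ⟹ the law).  The one-member case is recovered: **`jointSetTransitiveG_singletons_of_jointTransitiveG`**.
[cite: MoonenZarhin1995Duke, Thm. 2.4] [cite: GaoUllmo2025, Thm 3.1] [cite: DixonMortimer1996, §2.1]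

## References
* [MoonenZarhin1995Duke] B. Moonen, Yu. Zarhin, Duke Math. J. 77 (1995), Thm. 2.4.  [GaoUllmo2025] Z. Gao, E. Ullmo, J. Inst. Math. Jussieu 25 (2025), Thm 3.1.
  [DixonMortimer1996] J. D. Dixon, B. Mortimer, *Permutation Groups*, GTM 163, §2.1.
-/

namespace Summit.HodgeConjecture.CorCM.Census.MultiFieldWeil

open Finset

variable {r : ℕ} {n : Fin r → ℕ}

/-- **Joint set-transitivity on the base tuple of position sets `P` over the family `𝒳`**: every tuple `Q` with `Q m ∈ 𝒳 m` is carried onto `P` by a member of `R`,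
in the sense `π m a ∈ P m ⟺ a ∈ Q m` (`Q m` is the preimage of `P m` under `π m`). [cite: DixonMortimer1996, §2.1] -/
def JointSetTransitiveG (R : Finset (PermsG n)) (P : ∀ m : Fin r, Finset (Fin (n m))) (𝒳 : ∀ m : Fin r, Finset (Finset (Fin (n m)))) : Prop :=
  ∀ Q : ∀ m : Fin r, Finset (Fin (n m)), (∀ m, Q m ∈ 𝒳 m) → ∃ π ∈ R, ∀ (m : Fin r) (a : Fin (n m)), π m a ∈ P m ↔ a ∈ Q m

/-! ### Preimages of position sets and the orbit of a slot -/

section Orbits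

/-- The preimage `σ⁻¹(P) = {a | σ a ∈ P}` of a position set under a slot permutation. [folklore] -/
def preG {k : ℕ} (σ : Equiv.Perm (Fin k)) (P : Finset (Fin k)) : Finset (Fin k) := univ.filter fun a => σ a ∈ P

/-- Membership in `preG`. [folklore] -/
@[simp] theorem mem_preG {k : ℕ} {σ : Equiv.Perm (Fin k)} {P : Finset (Fin k)} {a : Fin k} : a ∈ preG σ P ↔ σ a ∈ P := by
  simp [preG]

/-- `preG 1 P = P`. [folklore] -/
theorem preG_one {k : ℕ} (P : Finset (Fin k)) : preG 1 P = P := by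
  ext a; simp [preG]

/-- `preG (σ τ) P = preG τ (preG σ P)` (a right action). [folklore] -/
theorem preG_mul {k : ℕ} (σ τ : Equiv.Perm (Fin k)) (P : Finset (Fin k)) : preG (σ * τ) P = preG τ (preG σ P) := by
  ext a; simp [preG, Equiv.Perm.mul_apply]

/-- `preG σ⁻¹ (preG σ P) = P`. [folklore] -/
theorem preG_inv_preG {k : ℕ} (σ : Equiv.Perm (Fin k)) (P : Finset (Fin k)) : preG σ⁻¹ (preG σ P) = P := by
  rw [← preG_mul, mul_inv_cancel, preG_one]

/-- `preG σ (preG σ⁻¹ P) = P`. [folklore] -/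
theorem preG_preG_inv {k : ℕ} (σ : Equiv.Perm (Fin k)) (P : Finset (Fin k)) : preG σ (preG σ⁻¹ P) = P := by
  rw [← preG_mul, inv_mul_cancel, preG_one]

/-- `P ↦ preG σ P` is injective. [folklore] -/
theorem preG_injective {k : ℕ} (σ : Equiv.Perm (Fin k)) : Function.Injective (preG σ) := fun P P' h => by
  rw [← preG_inv_preG σ P, h, preG_inv_preG]

variable (R : Finset (PermsG n)) (P : ∀ m : Fin r, Finset (Fin (n m)))

/-- **The `R`-orbit of the position set of slot `m`**: the preimages `π_m⁻¹(P m)`, `π ∈ R`. [cite: DixonMortimer1996, §1.6] -/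
def orbitG (m : Fin r) : Finset (Finset (Fin (n m))) := R.image fun π => preG (π m) (P m)

variable {R P}

/-- Membership in the orbit. [folklore] -/
theorem mem_orbitG {m : Fin r} {Q : Finset (Fin (n m))} : Q ∈ orbitG R P m ↔ ∃ π ∈ R, preG (π m) (P m) = Q := Finset.mem_image

/-- A product-closed, inverse-closed, non-empty `R` contains `1`. [folklore] -/
theorem one_mem_of_closed (hmul : ∀ π ∈ R, ∀ π' ∈ R, π * π' ∈ R) (hinv : ∀ π ∈ R, π⁻¹ ∈ R) (hne : R.Nonempty) : (1 : PermsG n) ∈ R := by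
  obtain ⟨π, hπ⟩ := hne
  have h := hmul π hπ _ (hinv π hπ)
  rwa [mul_inv_cancel] at h

/-- `P m ∈ orbitG R P m` when `1 ∈ R`. [folklore] -/
theorem self_mem_orbitG (h1 : (1 : PermsG n) ∈ R) (m : Fin r) : P m ∈ orbitG R P m :=
  mem_orbitG.2 ⟨1, h1, by rw [Pi.one_apply, preG_one]⟩

/-- The orbit is stable under preimages by members of `R`. [folklore] -/
theorem preG_mem_orbitG (hmul : ∀ π ∈ R, ∀ π' ∈ R, π * π' ∈ R) {m : Fin r} {π : PermsG n} (hπ : π ∈ R) {Q : Finset (Fin (n m))}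
    (hQ : Q ∈ orbitG R P m) : preG (π m) Q ∈ orbitG R P m := by
  obtain ⟨π', hπ', rfl⟩ := mem_orbitG.1 hQ
  exact mem_orbitG.2 ⟨π' * π, hmul π' hπ' π hπ, by rw [Pi.mul_apply, preG_mul]⟩


end Orbits

/-- The signed sum through a preimage: if `σ a ∈ P ⟺ a ∈ Q` then `Σ_a (σ a ∈ P ? f a : −f a) = 2 Σ_{a ∈ Q} f a − Σ f`. [folklore] -/
theorem sum_ite_mem_eq_of_iff {k : ℕ} {σ : Equiv.Perm (Fin k)} {P Q : Finset (Fin k)} (hQ : ∀ a, σ a ∈ P ↔ a ∈ Q) (f : Fin k → ℤ) :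
    (∑ a : Fin k, (if σ a ∈ P then f a else -f a)) = 2 * (∑ a ∈ Q, f a) - ∑ a : Fin k, f a := by
  rw [sum_ite_mem_eq]
  have hfilter : (univ.filter fun a => σ a ∈ P) = Q := by
    ext a
    rw [Finset.mem_filter]
    exact ⟨fun h => (hQ a).1 h.2, fun h => ⟨Finset.mem_univ _, (hQ a).2 h⟩⟩
  rw [hfilter]

/-! ### Separation: families of subsets whose equal sums force a constant function -/

/-- **Singletons separate**: if `𝒳` contains every singleton and `Σ_{a ∈ Q} f` is the same for all `Q ∈ 𝒳`, then `f` is constant. [folklore] -/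
theorem sep_of_singletons {k : ℕ} {𝒳 : Finset (Finset (Fin k))} (h𝒳 : ∀ a : Fin k, ({a} : Finset (Fin k)) ∈ 𝒳) {P : Finset (Fin k)}
    (f : Fin k → ℤ) (h : ∀ Q ∈ 𝒳, ∑ a ∈ Q, f a = ∑ a ∈ P, f a) (a b : Fin k) : f a = f b := by
  have ha := h {a} (h𝒳 a)
  have hb := h {b} (h𝒳 b)
  rw [Finset.sum_singleton] at ha hb
  rw [ha, hb]

/-- **All `p`-subsets separate** (`0 < p < k`): if `Σ_{a ∈ Q} f` is the same for all `p`-subsets `Q`, then `f` is constant — for `a ≠ b` compare `A ∪ {a}` and `A ∪ {b}`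
for a `(p−1)`-subset `A` avoiding both. [folklore] -/
theorem sep_of_powersetCard {k p : ℕ} (hp : 0 < p) (hpk : p < k) {𝒳 : Finset (Finset (Fin k))} (h𝒳 : ∀ Q : Finset (Fin k), Q.card = p → Q ∈ 𝒳)
    {P : Finset (Fin k)} (f : Fin k → ℤ) (h : ∀ Q ∈ 𝒳, ∑ a ∈ Q, f a = ∑ a ∈ P, f a) (a b : Fin k) : f a = f b := by
  by_cases hab : a = b
  · rw [hab]
  -- a `(p-1)`-subset avoiding `a` and `b`
  have hcard : p - 1 ≤ ((univ : Finset (Fin k)).erase a |>.erase b).card := by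
    rw [Finset.card_erase_of_mem (Finset.mem_erase.2 ⟨Ne.symm hab, Finset.mem_univ b⟩), Finset.card_erase_of_mem (Finset.mem_univ a),
      Finset.card_univ, Fintype.card_fin]
    omega
  obtain ⟨A, hA, hAcard⟩ := Finset.exists_subset_card_eq hcard
  have haA : a ∉ A := fun h' => by
    have := hA h'
    rw [Finset.mem_erase, Finset.mem_erase] at this
    exact this.2.1 rfl
  have hbA : b ∉ A := fun h' => by
    have := hA h'
    rw [Finset.mem_erase] at this
    exact this.1 rfl
  have hca : (insert a A).card = p := by rw [Finset.card_insert_of_notMem haA, hAcard]; omega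
  have hcb : (insert b A).card = p := by rw [Finset.card_insert_of_notMem hbA, hAcard]; omega
  have h1 := h _ (h𝒳 _ hca)
  have h2 := h _ (h𝒳 _ hcb)
  rw [Finset.sum_insert haA] at h1
  rw [Finset.sum_insert hbA] at h2
  linarith

/-! ### Assembly: constant defects give the law -/

section Assembly

variable {R : Finset (PermsG n)} {P : ∀ m : Fin r, Finset (Fin (n m))}

/-- **All slot defects constant ⟹ THE DEFECT LAW**: the signed equation at ONE tuple of `R` then reads `e = Σ_m (n_m − 2|P m|) t_m`. [folklore] -/
theorem exists_defects_of_const (hne : R.Nonempty) {e : ℤ} {d : ∀ m : Fin r, Fin (n m) → ℤ}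
    (hconst : ∀ (m : Fin r) (a b : Fin (n m)), d m a = d m b)
    (h : ∀ π ∈ R, e + ∑ m : Fin r, ∑ a : Fin (n m), (if π m a ∈ P m then d m a else -d m a) = 0) :
    ∃ t : Fin r → ℤ, (∀ (m : Fin r) (a : Fin (n m)), d m a = t m) ∧ e = ∑ m : Fin r, ((n m : ℤ) - 2 * (P m).card) * t m := by
  classical
  -- a base value in each slot (empty slots carry no defect)
  refine ⟨fun m => if hm : 0 < n m then d m ⟨0, hm⟩ else 0, fun m a => ?_, ?_⟩
  · have hm : 0 < n m := lt_of_le_of_lt (Nat.zero_le _) a.2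
    show d m a = (if hm : 0 < n m then d m ⟨0, hm⟩ else 0)
    rw [dif_pos hm]
    exact hconst m a _
  · show e = ∑ m : Fin r, ((n m : ℤ) - 2 * (P m).card) * (if hm : 0 < n m then d m ⟨0, hm⟩ else 0)
    obtain ⟨π, hπ⟩ := hne
    have h0 := h π hπ
    have hslot : ∀ m : Fin r, (∑ a : Fin (n m), (if π m a ∈ P m then d m a else -d m a)) =
        (2 * ((P m).card : ℤ) - n m) * (if hm : 0 < n m then d m ⟨0, hm⟩ else 0) := by
      intro m
      by_cases hm : 0 < n m
      · rw [dif_pos hm, ← sum_ite_mem_const (π m) (P m) (d m ⟨0, hm⟩)]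
        exact Finset.sum_congr rfl fun a _ => by rw [hconst m a ⟨0, hm⟩]
      · rw [dif_neg hm, mul_zero]
        exact Finset.sum_eq_zero fun a _ => absurd a.2 (by have := Nat.eq_zero_of_not_pos hm; omega)
    rw [Finset.sum_congr rfl fun m _ => hslot m] at h0
    have : e = -∑ m : Fin r, (2 * ((P m).card : ℤ) - n m) * (if hm : 0 < n m then d m ⟨0, hm⟩ else 0) := by linarith
    rw [this, ← Finset.sum_neg_distrib]
    exact Finset.sum_congr rfl fun m _ => by ring

end Assembly

/-! ### The defect law, SLOTWISE: a set `S` of slots peeled by joint set-transitivity once the other slots are known constant -/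

section Defect

variable {R : Finset (PermsG n)} {P : ∀ m : Fin r, Finset (Fin (n m))} {𝒳 : ∀ m : Fin r, Finset (Finset (Fin (n m)))}

/-- **CONSTANT DEFECTS ON A SET OF SLOTS FROM JOINT SET-TRANSITIVITY ON THOSE SLOTS**, given that the defects of the OTHER slots are already constant (peeled before, e.g. by a
pure rotation): `(P m)_{m ∈ S} ∈ ∏_S 𝒳`, `R` jointly set-transitive onto it over `∏_{m ∈ S} 𝒳 m`, each `𝒳 m` (`m ∈ S`) separating.  The contribution of a constant slot to the
signed equation does not depend on the tuple (`sum_ite_mem_const`), so the comparison argument runs inside `S`. [cite: MoonenZarhin1995Duke, Thm. 2.4] [cite: GaoUllmo2025, Thm 3.1] -/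
theorem const_of_signed_jointSetTransitive_on (S : Finset (Fin r)) (hP : ∀ m ∈ S, P m ∈ 𝒳 m)
    (hjt : ∀ Q : ∀ m : Fin r, Finset (Fin (n m)), (∀ m ∈ S, Q m ∈ 𝒳 m) → ∃ π ∈ R, ∀ m ∈ S, ∀ a : Fin (n m), π m a ∈ P m ↔ a ∈ Q m)
    (hsep : ∀ m ∈ S, ∀ f : Fin (n m) → ℤ, (∀ Q ∈ 𝒳 m, ∑ a ∈ Q, f a = ∑ a ∈ P m, f a) → ∀ a b : Fin (n m), f a = f b)
    {e : ℤ} {d : ∀ m : Fin r, Fin (n m) → ℤ} (hout : ∀ m, m ∉ S → ∀ a b : Fin (n m), d m a = d m b)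
    (h : ∀ π ∈ R, e + ∑ m : Fin r, ∑ a : Fin (n m), (if π m a ∈ P m then d m a else -d m a) = 0) :
    ∀ m ∈ S, ∀ a b : Fin (n m), d m a = d m b := by
  classical
  -- the slot sums: controlled by the tuple on `S`, constant off `S`
  let F : (∀ m : Fin r, Finset (Fin (n m))) → Fin r → ℤ := fun Q m =>
    if m ∈ S then 2 * (∑ a ∈ Q m, d m a) - ∑ a : Fin (n m), d m a
    else (2 * ((P m).card : ℤ) - n m) * (if hm : 0 < n m then d m ⟨0, hm⟩ else 0)
  have hF : ∀ π ∈ R, ∀ Q : ∀ m : Fin r, Finset (Fin (n m)), (∀ m ∈ S, ∀ a : Fin (n m), π m a ∈ P m ↔ a ∈ Q m) →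
      ∀ m, (∑ a : Fin (n m), (if π m a ∈ P m then d m a else -d m a)) = F Q m := by
    intro π _ Q hQ m
    by_cases hmS : m ∈ S
    · simp only [F, if_pos hmS]
      exact sum_ite_mem_eq_of_iff (hQ m hmS) (d m)
    · simp only [F, if_neg hmS]
      by_cases hm : 0 < n m
      · rw [dif_pos hm, ← sum_ite_mem_const (π m) (P m) (d m ⟨0, hm⟩)]
        exact Finset.sum_congr rfl fun a _ => by rw [hout m hmS a ⟨0, hm⟩]
      · rw [dif_neg hm, mul_zero]
        exact Finset.sum_eq_zero fun a _ => absurd a.2 (by have := Nat.eq_zero_of_not_pos hm; omega)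
  -- the equation at a tuple of translates on `S`
  have heq : ∀ Q : ∀ m : Fin r, Finset (Fin (n m)), (∀ m ∈ S, Q m ∈ 𝒳 m) → e + ∑ m : Fin r, F Q m = 0 := by
    intro Q hQ
    obtain ⟨π, hπ, hπQ⟩ := hjt Q hQ
    have h1 := h π hπ
    rw [Finset.sum_congr rfl fun m _ => hF π hπ Q hπQ m] at h1
    exact h1
  -- `D_m` is constant on `𝒳 m` for `m ∈ S`: compare the base tuple with the base tuple changed at `m₀`
  intro m₀ hm₀
  refine hsep m₀ hm₀ (d m₀) fun Q hQ => ?_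
  have h1 := heq (Function.update P m₀ Q) fun m hm => by
    by_cases hmm : m = m₀
    · subst hmm; rw [Function.update_self]; exact hQ
    · rw [Function.update_of_ne hmm]; exact hP m hm
  have h2 := heq P hP
  have hsplit : ∀ X : ∀ m : Fin r, Finset (Fin (n m)), (∑ m : Fin r, F X m) = F X m₀ + ∑ m ∈ univ.erase m₀, F X m := fun X =>
    (Finset.add_sum_erase univ (fun m => F X m) (Finset.mem_univ m₀)).symm
  have hrest : (∑ m ∈ univ.erase m₀, F (Function.update P m₀ Q) m) = ∑ m ∈ univ.erase m₀, F P m :=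
    Finset.sum_congr rfl fun m hm => by
      simp only [F]
      rw [Function.update_of_ne (Finset.ne_of_mem_erase hm)]
  have hF₀ : ∀ X : ∀ m : Fin r, Finset (Fin (n m)), F X m₀ = 2 * (∑ a ∈ X m₀, d m₀ a) - ∑ a : Fin (n m₀), d m₀ a := fun X => by
    simp only [F, if_pos hm₀]
  rw [hsplit, hrest, hF₀, Function.update_self] at h1
  rw [hsplit, hF₀] at h2
  linarith

/-- **THE DEFECT LAW FROM JOINT SET-TRANSITIVITY (integer form, all slots at once).**  `(P m)_m ∈ ∏ 𝒳`, `R` jointly set-transitive onto `P` over `∏ 𝒳` and non-empty, each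
`𝒳 m` separating: if `e`, `d` satisfy the signed equation at every tuple of `R`, then `d_m ≡ t_m` and `e = Σ_m (n_m − 2|P m|) t_m`. [cite: MoonenZarhin1995Duke, Thm. 2.4]
[cite: GaoUllmo2025, Thm 3.1] -/
theorem defectG_of_signed_jointSetTransitive (hP : ∀ m, P m ∈ 𝒳 m) (hjt : JointSetTransitiveG R P 𝒳) (hne : R.Nonempty)
    (hsep : ∀ (m : Fin r) (f : Fin (n m) → ℤ), (∀ Q ∈ 𝒳 m, ∑ a ∈ Q, f a = ∑ a ∈ P m, f a) → ∀ a b : Fin (n m), f a = f b)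
    {e : ℤ} {d : ∀ m : Fin r, Fin (n m) → ℤ}
    (h : ∀ π ∈ R, e + ∑ m : Fin r, ∑ a : Fin (n m), (if π m a ∈ P m then d m a else -d m a) = 0) :
    ∃ t : Fin r → ℤ, (∀ (m : Fin r) (a : Fin (n m)), d m a = t m) ∧ e = ∑ m : Fin r, ((n m : ℤ) - 2 * (P m).card) * t m := by
  have hconst : ∀ m ∈ (univ : Finset (Fin r)), ∀ a b : Fin (n m), d m a = d m b :=
    const_of_signed_jointSetTransitive_on univ (fun m _ => hP m)
      (fun Q hQ => by
        obtain ⟨π, hπ, hπQ⟩ := hjt Q fun m => hQ m (Finset.mem_univ m)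
        exact ⟨π, hπ, fun m _ a => hπQ m a⟩)
      (fun m _ => hsep m) (fun m hm => absurd (Finset.mem_univ m) hm) h
  exact exists_defects_of_const hne (fun m => hconst m (Finset.mem_univ m)) h

end Defect

/-! ### The defect law for configurations -/

section Config

variable {α : Type*} {R : Finset (PermsG n)} {P : ∀ m : Fin r, Finset (Fin (n m))} {𝒳 : ∀ m : Fin r, Finset (Finset (Fin (n m)))} {v : α → PtG n}

/-- **THE DEFECT LAW FOR CONFIGURATIONS, any number of several-member types under joint set-transitivity**: an `R`-balanced configuration obeys the defect law with
curve multiplicities `c_m = n_m − 2|P m|` (`2|P m| ≤ n_m`) — the hypothesis `hdef` of `MultiFieldWeil.hodgeConjectureFor_biproduct_comp_of_defectLawG`.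
[cite: MoonenZarhin1995Duke, Thm. 2.4] [cite: GaoUllmo2025, Thm 3.1] -/
theorem exists_hasDefectsG_of_jointSetTransitiveG (hP : ∀ m, P m ∈ 𝒳 m) (hjt : JointSetTransitiveG R P 𝒳) (hne : R.Nonempty)
    (hsep : ∀ (m : Fin r) (f : Fin (n m) → ℤ), (∀ Q ∈ 𝒳 m, ∑ a ∈ Q, f a = ∑ a ∈ P m, f a) → ∀ a b : Fin (n m), f a = f b)
    (hc : ∀ m, 2 * (P m).card ≤ n m) {T : Finset α} (hT : ModelBalancedG P R v T) :
    ∃ t : Fin r → ℤ, HasDefectsG (fun m => n m - 2 * (P m).card) v T t := by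
  obtain ⟨t, hd, he⟩ := defectG_of_signed_jointSetTransitive hP hjt hne hsep (e := (cnt v T (Sum.inl true) : ℤ) - cnt v T (Sum.inl false))
    (d := fun m a => (cnt v T (Sum.inr ⟨m, (a, true)⟩) : ℤ) - cnt v T (Sum.inr ⟨m, (a, false)⟩))
    fun π hπ => signed_of_modelBalancedG R v hT hπ
  refine ⟨t, fun m a => hd m a, ?_⟩
  rw [he]
  exact Finset.sum_congr rfl fun m _ => by rw [Nat.cast_sub (hc m)]; push_cast; ring

/-- **Balanced under a jointly set-transitive `R` ⟹ balanced under every set of tuples.** [folklore] -/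
theorem ModelBalancedG.of_jointSetTransitiveG (hP : ∀ m, P m ∈ 𝒳 m) (hjt : JointSetTransitiveG R P 𝒳) (hne : R.Nonempty)
    (hsep : ∀ (m : Fin r) (f : Fin (n m) → ℤ), (∀ Q ∈ 𝒳 m, ∑ a ∈ Q, f a = ∑ a ∈ P m, f a) → ∀ a b : Fin (n m), f a = f b)
    (hc : ∀ m, 2 * (P m).card ≤ n m) {T : Finset α} (hT : ModelBalancedG P R v T) (R' : Finset (PermsG n)) : ModelBalancedG P R' v T := by
  obtain ⟨t, ht⟩ := exists_hasDefectsG_of_jointSetTransitiveG hP hjt hne hsep hc hT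
  refine modelBalancedG_of_hasDefects (fun m => ?_) ht R'
  rw [Nat.cast_sub (hc m)]
  push_cast
  ring

end Config

/-! ### The one-member case recovered -/

/-- One-member position sets, `R` jointly transitive on the base POINTS ⟹ jointly set-transitive onto `({p m})_m` over the singletons. [cite: DixonMortimer1996, §2.1] -/
theorem jointSetTransitiveG_singletons_of_jointTransitiveG {R : Finset (PermsG n)} {p : ∀ m : Fin r, Fin (n m)} (hjt : JointTransitiveG R p) :
    JointSetTransitiveG R (fun m => {p m}) (fun m => univ.image fun a : Fin (n m) => ({a} : Finset (Fin (n m)))) := by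
  classical
  intro Q hQ
  have hx : ∀ m, ∃ x : Fin (n m), Q m = {x} := fun m => by
    obtain ⟨x, -, hx⟩ := Finset.mem_image.1 (hQ m)
    exact ⟨x, hx.symm⟩
  choose x hx using hx
  obtain ⟨π, hπ, hπx⟩ := hjt x
  refine ⟨π, hπ, fun m a => ?_⟩
  rw [hx m, Finset.mem_singleton, Finset.mem_singleton, ← hπx m]
  exact ⟨fun h => (π m).injective h, fun h => by rw [h]⟩

end Summit.HodgeConjecture.CorCM.Census.MultiFieldWeil
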